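import Literature.AlgebraicGeometry.Limits.LocalizationEtaleSpread
import Literature.AlgebraicGeometry.Limits.LocalizationFiniteSpread
import Mathlib.RingTheory.Unramified.LocalStructure
import HarnessLib

/-!
# Finite étale morphisms spread out from `Spec A_S` to a stage `Spec A[1/s]`

Topic: `Literature/AlgebraicGeometry/Limits`; the conjunction of `Limits/LocalizationEtaleSpread`
(étaleness) and `Limits/LocalizationFiniteSpread` (finiteness): for a morphism `f : Q → P` of
`A`-schemes (`A` a commutative ring, `S ⊆ A` a submonoid, `B = A_S`), separated, quasi-compact and
locally of finite presentation, `P` quasi-compact over `A`, **if the base change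
`f_B : Q ×_A Spec B → P ×_A Spec B` is finite étale then so is `f_T` for every model `T` of `A[1/t]`,
`t` any multiple of some `s ∈ S`** (`LocApprox.exists_forall_isFinite_and_etale_whiskerRight`;
EGA IV₃ 8.10.5 (x) and IV₄ 17.7.8 (ii); The Stacks Project, Tags 01ZO, 07RP). With `A` a domain and
`B = Frac A` (`S = A⁰`): a finite étale cover of the generic fibre `P_η` which is the generic fibre
of a separated `f` of finite presentation is finite étale over a dense open `D(s) ⊆ Spec A` — the
algebraic "spreading out" of finite étale covers used to descend them to `ℚ̄`-points
(Voisin, *Hodge loci and absolute Hodge classes*, §3; SGA1 XIII for the `π₁`-statement).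

The link between the two files: the open `W ⊆ Q` on which `f` is étale
(`exists_range_fst_subset_of_smoothOfRelativeDimension`, `n = 0`) consists of quasi-finite points
of `f` (étale ⇒ locally quasi-finite) and contains the image of `Q ×_A Spec B`, which is the
quasi-finiteness input of the finiteness spreading.

Everything is proved; no definitions, no named facts.

## References

* A. Grothendieck, J. Dieudonné, EGA IV₃ Thm. 8.10.5 (x); EGA IV₄ Prop. 17.7.8 (ii). [EGAIV3] [EGAIV4]
* The Stacks Project, Tags 01ZO, 07RP, 0C0C, 03GW. [StacksProject]
-/

noncomputable section

universe u

open CategoryTheory CategoryTheory.Limits AlgebraicGeometry TopologicalSpace MonoidalCategory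
open Opposite

namespace Literature.AlgebraicGeometry.Limits

namespace LocApprox

open Literature.AlgebraicGeometry.Motives (SchemeOver specOver)

set_option backward.isDefEq.respectTransparency false

/-- Étale morphisms are locally quasi-finite (affine-locally an étale algebra is formally
unramified of finite type, hence quasi-finite — Mathlib instance in
`Mathlib.RingTheory.Unramified.LocalStructure`; same statement and proof as
`Literature.AlgebraicGeometry.Motives.locallyQuasiFinite_of_etale`, kept private to keep the
imports light). [folklore] -/
private theorem locallyQuasiFinite_of_etale'' {X Y : Scheme.{u}} (f : X ⟶ Y) [Etale f] :
    LocallyQuasiFinite f := by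
  rw [HasRingHomProperty.iff_appLE (P := @LocallyQuasiFinite)]
  intro U V e
  have h : (f.appLE U V e).hom.Etale :=
    HasRingHomProperty.appLE (P := @Etale) f inferInstance U V e
  algebraize [(f.appLE U V e).hom]
  change Algebra.QuasiFinite _ _
  have : Algebra.Etale Γ(Y, U) Γ(X, V) := h
  infer_instance

section Limit

variable {A : Type u} [CommRing A] (S : Submonoid A) (B : Type u) [CommRing B] [Algebra A B]
  [IsLocalization S B] {Q P : SchemeOver A} (f : Q ⟶ P)

include S in
/-- If `f_B` is étale (`f` locally of finite presentation, `Q` quasi-compact over `A`), the image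
of `Q ×_A Spec B → Q` consists of quasi-finite points of `f`: it lies in the open `W ⊆ Q` on which
`f` is étale (`exists_range_fst_subset_of_smoothOfRelativeDimension`, through the stage
`Q ×_A Spec A[1/s] ⊇ im (Q ×_A Spec B)`), and étale morphisms are locally quasi-finite.
[cite: StacksProject, Tags 0C0C and 03GW] -/
theorem range_fst_subset_quasiFiniteLocus_of_etale [QuasiCompact Q.hom]
    [LocallyOfFinitePresentation f.left] [Etale (f ▷ specOver A B).left] :
    Set.range (pullback.fst Q.hom (specOver A B).hom) ⊆ (f.left.quasiFiniteLocus : Set Q.left) := by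
  obtain ⟨W, s, hW, hs⟩ := exists_range_fst_subset_of_smoothOfRelativeDimension S B f 0
  -- `Q ×_A Spec B → Q` factors through the stage `s`
  have hB : Set.range (pullback.fst Q.hom (specOver A B).hom) ⊆ (W : Set Q.left) := by
    rintro _ ⟨x, rfl⟩
    have e : pullback.fst Q.hom (specOver A B).hom x =
        pullback.fst Q.hom ((baseDiagram S).obj s).hom ((prodCone S B Q).π.app s x) := by
      change _ = ((prodCone S B Q).π.app s ≫ pullback.fst _ _) x
      rw [prodCone_π_app_fst]
      rfl
    rw [e]
    exact hs ⟨_, rfl⟩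
  -- `W` consists of quasi-finite points: `W → P` is étale
  refine hB.trans fun x hx ↦ ?_
  haveI : Etale (W.ι ≫ f.left) := (Etale.iff_smoothOfRelativeDimension_zero (W.ι ≫ f.left)).mpr hW
  haveI : LocallyQuasiFinite (W.ι ≫ f.left) := locallyQuasiFinite_of_etale'' _
  have h := (W.ι ≫ f.left).quasiFiniteAt ⟨x, hx⟩
  rw [Scheme.Hom.quasiFiniteAt_comp_iff_of_isOpenImmersion] at h
  exact h

/-- **Finite étale morphisms descend through `Spec A_S = lim Spec A[1/s]`** (EGA IV₃ 8.10.5 (x),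
IV₄ 17.7.8 (ii); Stacks 01ZO, 07RP, for the system of basic opens `D(s)`, `s ∈ S`). Let `f : Q → P`
be a separated, quasi-compact morphism locally of finite presentation of `A`-schemes, `P`
quasi-compact over `A`, with `f_B : Q ×_A Spec B → P ×_A Spec B` finite étale, `B = A_S`. Then there is
`s ∈ S` such that `f_T` is finite étale for every model `T` of `A[1/t]`, `t` any multiple of `s`.
[cite: EGAIV3, Thm. 8.10.5 (x)] [cite: EGAIV4, Prop. 17.7.8 (ii)]
[cite: StacksProject, Tags 01ZO and 07RP] -/
theorem exists_forall_isFinite_and_etale_whiskerRight [QuasiCompact P.hom] [QuasiCompact f.left]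
    [IsSeparated f.left] [LocallyOfFinitePresentation f.left]
    [IsFinite (f ▷ specOver A B).left] [Etale (f ▷ specOver A B).left] :
    ∃ s ∈ S, ∀ t : A, s ∣ t → ∀ (T : Type u) [CommRing T] [Algebra A T] [IsLocalization.Away t T],
      IsFinite (f ▷ specOver A T).left ∧ Etale (f ▷ specOver A T).left := by
  haveI : QuasiCompact Q.hom := by rw [← Over.w f]; infer_instance
  have hqf := range_fst_subset_quasiFiniteLocus_of_etale S B f
  obtain ⟨s₁, hs₁, h₁⟩ := exists_forall_isFinite_whiskerRight S B f hqf
  obtain ⟨s₂, hs₂, h₂⟩ := exists_forall_etale_whiskerRight S B f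
  refine ⟨s₁ * s₂, S.mul_mem hs₁ hs₂, fun t hst T _ _ _ => ⟨?_, ?_⟩⟩
  · exact h₁ t (dvd_trans (dvd_mul_right s₁ s₂) hst) T
  · exact h₂ t (dvd_trans (dvd_mul_left s₂ s₁) hst) T

end Limit

end LocApprox

end Literature.AlgebraicGeometry.Limits

end
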